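import Summits.CriticalPhenomena.PercolationContinuityZ3.Theorems.Transplant.Slab111VSwap
import HarnessLib
/-!
# The routing certificate for `ShapedLinkage 3 (Slab111.hexShadow k)`, VI: the LEVEL LEMMAS — reading the checker's level data

builds on p205010 (kernel theorem, internal audit signed; external expert review pending) — NOT used in this file.  Lane `prim-bschramm`, seat
`prim-bschramm-p2` (gen 35; class C1b; memo `HOME/bschramm/P2-LATTICES.md` §129); helper file (`--supports stmt-CriticalPhenomena-4575 --as helper`).
Preparations for placing a checked plan («Slab111VSwapPlan»): the arithmetic of statuses and residues, the envelope bounds `botFloor_le`,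
`le_sub_topOff`, and the level facts `LevelOK` («Slab111VSoundC») of a placement read off the checker's contact conditions (`contactBotOK`,
`contactTopOK`, «Slab111VPlan»).
* §1 arithmetic: `exists_level_mod3`, status lemmas, `dvd_level_cls`, `botFloor_le`, `le_sub_topOff`, `three_le_sub_of_same_col`;
* §2 reading `levelsOK`, `contactBotOK`, `contactTopOK` (`contactBot_spec`, `contactTop_spec`, `levelOK_of_contacts`).
[cite: DuminilCopinSidoraviciusTassion2016, §2.3 (proof of Fact 2)]
-/

noncomputable section

namespace Summit.CriticalPhenomena.PercolationContinuityZ3.Theorems.Transplant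

open Literature.Probability.Percolation Literature.Probability.LatticeModels SimpleGraph
open scoped Classical

namespace Slab111

variable {k : ℕ}


/-! ## §1 Arithmetic -/

/-- Three consecutive integers contain every residue. [folklore] -/
theorem exists_level_mod3 {a b r : ℤ} (hab : a + 2 ≤ b) (hr0 : 0 ≤ r) (hr3 : r < 3) : ∃ ℓ : ℤ, a ≤ ℓ ∧ ℓ ≤ b ∧ ℓ % 3 = r := by
  refine ⟨a + ((r - a) % 3), by omega, by omega, by omega⟩

/-- A low status determines the level. [folklore] -/
theorem level_of_status_le_two (_hk : 5 ≤ k) {h : ℤ} (h0 : 0 ≤ h) (hh : h ≤ k) (hs : statusOf k h ≤ 2) : h ≤ 2 ∧ (statusOf k h : ℤ) = h := by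
  unfold statusOf at hs ⊢
  split_ifs at hs ⊢ with h2 h3 <;> omega

/-- A middle status bounds the level. [folklore] -/
theorem level_of_status_eq_nine (_hk : 5 ≤ k) {h : ℤ} (h0 : 0 ≤ h) (hh : h ≤ k) (hs : statusOf k h = 9) : 3 ≤ h ∧ h ≤ (k : ℤ) - 3 := by
  unfold statusOf at hs
  split_ifs at hs with h2 h3 <;> omega

/-- A high status determines the level. [folklore] -/
theorem level_of_status_ge_ten (hk : 5 ≤ k) {h : ℤ} (h0 : 0 ≤ h) (hh : h ≤ k) (hs : 10 ≤ statusOf k h) : (k : ℤ) - 2 ≤ h ∧ (statusOf k h : ℤ) = 12 - ((k : ℤ) - h) := by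
  unfold statusOf at hs ⊢
  split_ifs at hs ⊢ with h2 h3 <;> omega

/-- A status `≤ 9` bounds the level by `k − 3`. [folklore] -/
theorem level_of_status_le_nine (_hk : 5 ≤ k) {h : ℤ} (h0 : 0 ≤ h) (_hh : h ≤ k) (hs : statusOf k h ≤ 9) : h ≤ (k : ℤ) - 3 := by
  unfold statusOf at hs
  split_ifs at hs with h2 h3 <;> omega

/-- A status `≥ 9` bounds the level below by `3`. [folklore] -/
theorem three_le_of_status_ge_nine (_hk : 5 ≤ k) {h : ℤ} (h0 : 0 ≤ h) (_hh : h ≤ k) (hs : 9 ≤ statusOf k h) : 3 ≤ h := by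
  unfold statusOf at hs
  split_ifs at hs with h2 h3 <;> omega

/-- The class of a terminal's level: `h ≡ cls z + lvlC c (mod 3)` for a film vertex over `vcol z c` at level `h`. [folklore] -/
theorem dvd_level_cls {z : Site 2} {c : Col} {X : slab111 k} (hX : sh X = vcol z c) : (3 : ℤ) ∣ lev (X : Site 3) - (cls z : ℤ) - lvlC c := by
  have h1 := (adm_self X).1
  rw [hX] at h1
  simp only [lvl, vcol_apply_zero, vcol_apply_one, lvlC] at h1 ⊢
  have hz := dvd_cls z
  have e : lev (X : Site 3) - (cls z : ℤ) - (c.1 + 2 * c.2) = (lev (X : Site 3) - (z 0 + c.1 + 2 * (z 1 + c.2))) + (z 0 + 2 * z 1 - (cls z : ℤ)) := by ring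
  rw [e]; exact dvd_add h1 hz

/-- **`botFloor` is a lower bound of every level `≥ 3` of the column's class.** [folklore] -/
theorem botFloor_le {c0 : ℕ} {c : Col} {h : ℤ} (h3 : 3 ≤ h) (hcls : (3 : ℤ) ∣ h - (c0 : ℤ) - lvlC c) : botFloor c0 c ≤ h := by
  unfold botFloor; omega

/-- **`k − topOff` is an upper bound of every level `≤ k − 3` of the column's class.** [folklore] -/
theorem le_sub_topOff {c0 : ℕ} {c : Col} {h : ℤ} (hk3 : h ≤ (k : ℤ) - 3) (hcls : (3 : ℤ) ∣ h - (c0 : ℤ) - lvlC c) : h ≤ (k : ℤ) - topOff c0 (k % 3) c := by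
  unfold topOff
  have := Int.emod_emod_of_dvd (k : ℤ) (dvd_refl (3 : ℤ))
  push_cast
  omega

/-- Two distinct film vertices over one column are at least three levels apart. [folklore] -/
theorem three_le_sub_of_same_col {X Y : slab111 k} (hs : sh X = sh Y) (hlt : lev (X : Site 3) < lev (Y : Site 3)) :
    lev (X : Site 3) + 3 ≤ lev (Y : Site 3) := by
  have h1 := (adm_self X).1
  have h2 := (adm_self Y).1
  rw [hs] at h1
  have : (3 : ℤ) ∣ lev (Y : Site 3) - lev (X : Site 3) := by
    have e : lev (Y : Site 3) - lev (X : Site 3) = (lev (Y : Site 3) - lvl (sh Y)) - (lev (X : Site 3) - lvl (sh Y)) := by ring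
    rw [e]; exact dvd_sub h2 h1
  omega

/-! ## §2 Reading the checker's level data -/

/-- Modus ponens for the Boolean implication. [folklore] -/
theorem bimp_mp {c x : Bool} (h : bimp c x = true) (hc : c = true) : x = true := by
  simp only [bimp, hc, Bool.not_true, Bool.false_or] at h; exact h

/-- From `contactBotOK … d`: codes at the absolute levels `0`, `1` and the port clause. [folklore] -/
theorem contactBot_spec {C : Ctx} {P : PlanD} {d : ℤ} (h : P.contactBotOK C d = true) :
    (∀ w ∈ P.rigid, ((d - P.lamMin) + w.2 = 0 → codeFree C 0 w.1 = true) ∧ ((d - P.lamMin) + w.2 = 1 → codeFree C 1 w.1 = true)) ∧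
    (∀ a e p, (TermD.ride a e, p) ∈ P.ridePorts → (d - P.lamMin) + p.2 = 0 → codeFree C 1 (a.colBot C.c0 1) = true) := by
  simp only [PlanD.contactBotOK, Bool.and_eq_true, List.all_eq_true] at h
  obtain ⟨h1, h2⟩ := h
  refine ⟨fun w hw => ?_, fun a e p htp he => ?_⟩
  · obtain ⟨ha, hb⟩ := h1 w hw
    exact ⟨fun e => bimp_mp ha (by simp [e]), fun e => bimp_mp hb (by simp [e])⟩
  · have := h2 _ htp
    simp only [portBotOK] at this
    exact bimp_mp this (by simp [he])

/-- From `contactTopOK … d` (placement with `ℓ + λmax = k − d`): codes at the absolute levels `k`, `k−1` and the port clause. [folklore] -/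
theorem contactTop_spec {C : Ctx} {P : PlanD} {d : ℤ} (h : P.contactTopOK C d = true) :
    (∀ w ∈ P.rigid, (d + P.lamMax - w.2 = 0 → codeFree C 3 w.1 = true) ∧ (d + P.lamMax - w.2 = 1 → codeFree C 2 w.1 = true)) ∧
    (∀ a e p, (TermD.ride a e, p) ∈ P.ridePorts → d + P.lamMax - p.2 = 0 → codeFree C 2 (a.colTop C.c0 C.kr 1) = true) := by
  simp only [PlanD.contactTopOK, Bool.and_eq_true, List.all_eq_true] at h
  obtain ⟨h1, h2⟩ := h
  refine ⟨fun w hw => ?_, fun a e p htp he => ?_⟩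
  · obtain ⟨ha, hb⟩ := h1 w hw
    exact ⟨fun e => bimp_mp ha (by simp [e]), fun e => bimp_mp hb (by simp [e])⟩
  · have := h2 _ htp
    simp only [portTopOK] at this
    exact bimp_mp this (by simp [he])

/-- Ride ports are rigid vertices. [folklore] -/
theorem ridePorts_rigid {P : PlanD} {tp : TermD × MV} (h : tp ∈ P.ridePorts) : tp.2 ∈ P.rigid := by
  simp only [PlanD.ridePorts, List.mem_append] at h
  rcases h with ((h | h) | h) | h
  · revert h
    cases P.t1 <;> cases hA : P.A.head? <;> simp
    rintro rfl; exact mem_rigid_iff.2 (Or.inl (List.mem_of_mem_head? hA))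
  · revert h
    cases P.t2 <;> cases hB : P.B.getLast? <;> simp
    rintro rfl; exact mem_rigid_iff.2 (Or.inr (Or.inr (Or.inr (Or.inl (List.mem_of_getLast? hB)))))
  · revert h
    cases P.t3a <;> cases hT : P.T1.getLast? <;> simp
    rintro rfl; exact mem_rigid_iff.2 (Or.inr (Or.inr (Or.inr (Or.inr (Or.inl (List.mem_of_getLast? hT))))))
  · revert h
    cases P.t3b <;> cases hT : P.T2.getLast? <;> simp
    rintro rfl; exact mem_rigid_iff.2 (Or.inr (Or.inr (Or.inr (Or.inr (Or.inr (List.mem_of_getLast? hT))))))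

/-- **`LevelOK` for a placement whose rigid levels are in `[0, k]` and whose possible boundary contacts are certified.** [folklore] -/
theorem levelOK_of_contacts {C : Ctx} {P : PlanD} {ℓ : ℤ} (h0 : 0 ≤ ℓ + P.lamMin) (hk : ℓ + P.lamMax ≤ k)
    (hb : ∀ d : ℤ, (d = 0 ∨ d = 1) → ℓ + P.lamMin = d → P.contactBotOK C d = true)
    (ht : ∀ d : ℤ, (d = 0 ∨ d = 1) → ℓ + P.lamMax = (k : ℤ) - d → P.contactTopOK C d = true) : LevelOK k C ℓ P := by
  constructor
  · intro w hw
    have h1 := lamMin_le hw; have h2 := le_lamMax hw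
    refine ⟨by omega, by omega, fun e => ?_, fun e => ?_, fun e => ?_, fun e => ?_⟩
    · have hd : ℓ + P.lamMin = 0 := by omega
      have := (contactBot_spec (hb 0 (Or.inl rfl) hd)).1 w hw
      exact this.1 (by omega)
    · rcases (show ℓ + P.lamMin = 0 ∨ ℓ + P.lamMin = 1 by omega) with hd | hd
      · exact ((contactBot_spec (hb 0 (Or.inl rfl) hd)).1 w hw).2 (by omega)
      · exact ((contactBot_spec (hb 1 (Or.inr rfl) hd)).1 w hw).2 (by omega)
    · rcases (show ℓ + P.lamMax = (k : ℤ) - 0 ∨ ℓ + P.lamMax = (k : ℤ) - 1 by omega) with hd | hd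
      · exact ((contactTop_spec (ht 0 (Or.inl rfl) hd)).1 w hw).2 (by omega)
      · exact ((contactTop_spec (ht 1 (Or.inr rfl) hd)).1 w hw).2 (by omega)
    · have hd : ℓ + P.lamMax = (k : ℤ) - 0 := by omega
      exact ((contactTop_spec (ht 0 (Or.inl rfl) hd)).1 w hw).1 (by omega)
  · intro tp htp
    have hprig := ridePorts_rigid htp
    have h1 := lamMin_le hprig; have h2 := le_lamMax hprig
    rcases tp with ⟨t, p⟩
    cases t with
    | exact v => trivial
    | ride a e =>
      simp only at h1 h2
      constructor
      · intro e0
        have hd : ℓ + P.lamMin = 0 := by omega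
        exact (contactBot_spec (hb 0 (Or.inl rfl) hd)).2 a e p htp (by omega)
      · intro ek
        have hd : ℓ + P.lamMax = (k : ℤ) - 0 := by omega
        exact (contactTop_spec (ht 0 (Or.inl rfl) hd)).2 a e p htp (by omega)

end Slab111

end Summit.CriticalPhenomena.PercolationContinuityZ3.Theorems.Transplant
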